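import Summits.HodgeConjecture.HodgeConjecture.Theorems.TropicalKugaSatakeCayleyEffectiveCayleyNonRealizabilityFormalClassKernel
import HarnessLib

/-!
# Formal chains over ANY integral linear family of period matrices: the period class lies in the
# common kernel of the family's eigenwaves; the rung `stub_rung_sixthDirection` of crux
# `EffectiveCayleyNonRealizability` (stmt-HodgeConjecture-18569) reduced to a kernel certificate

Route `TropicalKugaSatakeCayley` of `HodgeConjecture`, line `formal_rational`. For an integral
linear family `B_s = Σ_i s_i • B i` (`B : ι → M_g(ℤ)`, `ι` finite) and a formal framed `2`-chain `𝒵`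
over `ℚ[s_ι]` whose evaluations have the constant rational period class `Mq` on a non-empty open
set `V` of positive-definite parameters:

* `eigenwave_compound_linearFamily_mul_eq_zero` — `eigenwave (compound 2 (B_s) · Mq) = 0` for EVERY
  `s ∈ ℝ^ι` (Mikhalkin–Zharkov Thm. 5.4 for chains at one algebraically independent `s₀ ∈ V`,
  `eigenwave_classOf`; the polynomial matrix `eigenwave (compound 2 (Σ X_i B i) · Mq)` over `ℚ[s]`
  then vanishes identically by injectivity of `aeval s₀`). The Kuga–Satake statement
  `eigenwave_compound_ksMatrix_mul_eq_zero` is the case `B = ksForm`; here it is applied to the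
  SIX-parameter family `F₊ = F_KS ⊕ ℚ B₆`, `B₆ = B₁ R₂ R₃ R₄ R₅` of the rung.
* `rung_sixthDirection_of_kernelCertificate` — the registered plan-only rung
  `stub_rung_sixthDirection` (formal cycles of `F₊`, effective with constant rational class `Mq` on an
  open set of positive-definite parameters, have `Mq ∈ ℚ • 1`; skeleton-local `ksSixth` /
  `ksMatrixPlus` / `evalChain₆` unfolded) FOLLOWS from the pure linear-algebra certificate
  "`K₊ ∩ ℚ^{28×28} = ℚ • 1`": every rational `Mq` with `eigenwave (compound 2 (B⁺_s) · Mq) = 0` for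
  all `s ∈ ℝ⁶` is a rational multiple of `1` (exact computation of record: `dim K₊ = 1`,
  `dim K(F_KS) = 6`, kit job j154563 with the tree's conventions; prior programme:
  `dim Hdg₂(F₊) = 1`). Neither the cycle condition nor effectivity nor affine-linearity is used —
  the rung is a statement about the family, not about positivity.

No named fact, no new definition, no sorry.
References: [MikhalkinZharkov2014Eigenwave] G. Mikhalkin, I. Zharkov, Tropical eigenwave and
intermediate Jacobians, LN UMI 15 (2014), Thm. 5.4; [Zharkov2020TropicalWeil] I. Zharkov,
arXiv:2002.02347, pp. 2–3.
-/

noncomputable section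

-- `Summit.HodgeConjecture.HodgeConjecture.…` is the mandated namespace (single-conjunct summit).
set_option linter.dupNamespace false

open scoped BigOperators Matrix

namespace Summit.HodgeConjecture.HodgeConjecture.Theorems.EffectiveCayleyNonRealizability

open Literature.AlgebraicGeometry.Tropical
open Literature.AlgebraicGeometry.Tropical.TropicalTorus

/-! ### Integral linear families -/

section Family

variable {ι : Type} {g : ℕ}

/-- Evaluating the formal period matrix `Σ_i X_i • B i ∈ M_g(ℚ[s_ι])` at `s ∈ ℝ^ι` gives
`B_s = Σ_i s_i • B i`. [folklore] -/
theorem linearFamily_map_aeval [Fintype ι] (B : ι → Matrix (Fin g) (Fin g) ℤ) (s : ι → ℝ) :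
    (∑ i, (MvPolynomial.X i : MvPolynomial ι ℚ) • (B i).map (Int.cast : ℤ → MvPolynomial ι ℚ)).map
        (MvPolynomial.aeval s) = ∑ i, s i • (B i).map (Int.cast : ℤ → ℝ) := by
  ext r c
  simp only [Matrix.map_apply, Matrix.sum_apply, Matrix.smul_apply, smul_eq_mul, map_sum, map_mul,
    MvPolynomial.aeval_X, map_intCast]

/-- At a parameter with algebraically independent coordinates the evaluation `aeval s` on `ℚ[s_ι]`
is injective. [folklore] -/
theorem injective_aeval_of_algebraicIndependent' {s : ι → ℝ} (hs : AlgebraicIndependent ℚ s) :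
    Function.Injective (MvPolynomial.aeval s : MvPolynomial ι ℚ →ₐ[ℚ] ℝ) :=
  algebraicIndependent_iff_injective_aeval.1 hs

/-- **The period class of a formal chain over an integral linear family lies in the common kernel
of the family's eigenwaves.** Let `B : ι → M_g(ℤ)` and let `𝒵` be a formal framed `2`-chain over
`ℚ[s_ι]` whose evaluations have constant rational period class `Mq` on a non-empty open set `V` of
parameters where `B_s` is positive definite. Then `eigenwave (compound 2 (B_s) · Mq) = 0` for EVERY
`s ∈ ℝ^ι`. [cite: MikhalkinZharkov2014Eigenwave, Thm. 5.4] [cite: Zharkov2020TropicalWeil, p. 3] -/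
theorem eigenwave_compound_linearFamily_mul_eq_zero [Fintype ι] (B : ι → Matrix (Fin g) (Fin g) ℤ)
    (𝒵 : Chain (MvPolynomial ι ℚ) g 2) (V : Set (ι → ℝ)) (hVo : IsOpen V) (hVne : V.Nonempty)
    (hVpd : ∀ s ∈ V, (∑ i, s i • (B i).map (Int.cast : ℤ → ℝ)).PosDef)
    (Mq : Matrix (Sub g 2) (Sub g 2) ℚ)
    (hV : ∀ s ∈ V, compound 2 (∑ i, s i • (B i).map (Int.cast : ℤ → ℝ))⁻¹ *
      (⟨𝒵.size, fun c => ⟨fun r => MvPolynomial.aeval s ((𝒵.cell c).base r), (𝒵.cell c).dir,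
          fun i j => MvPolynomial.aeval s ((𝒵.cell c).coef i j), (𝒵.cell c).weight⟩⟩ :
          Chain ℝ g 2).classOf = Mq.map (algebraMap ℚ ℝ)) (s : ι → ℝ) :
    eigenwave (q := 1) (compound 2 (∑ i, s i • (B i).map (Int.cast : ℤ → ℝ)) *
      Mq.map (algebraMap ℚ ℝ)) = 0 := by
  -- the polynomial matrix `F = eigenwave (compound 2 (Σ X_i B i) · Mq)` over `ℚ[s]`
  set P : Matrix (Fin g) (Fin g) (MvPolynomial ι ℚ) :=
    ∑ i, (MvPolynomial.X i : MvPolynomial ι ℚ) • (B i).map (Int.cast : ℤ → MvPolynomial ι ℚ) with hP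
  set F : Matrix (Sub g 1) (Sub g (1 + 2)) (MvPolynomial ι ℚ) :=
    eigenwave (q := 1) (compound 2 P * Mq.map (algebraMap ℚ (MvPolynomial ι ℚ))) with hF
  have hFeval : ∀ s' : ι → ℝ, F.map (MvPolynomial.aeval s') =
      eigenwave (q := 1) (compound 2 (∑ i, s' i • (B i).map (Int.cast : ℤ → ℝ)) *
        Mq.map (algebraMap ℚ ℝ)) := by
    intro s'
    let φ : MvPolynomial ι ℚ →+* ℝ := (MvPolynomial.aeval s').toRingHom
    have e1 : F.map (MvPolynomial.aeval s') = F.map φ := rfl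
    have e2 : P.map φ = ∑ i, s' i • (B i).map (Int.cast : ℤ → ℝ) := linearFamily_map_aeval B s'
    have e3 : (Mq.map (algebraMap ℚ (MvPolynomial ι ℚ))).map φ = Mq.map (algebraMap ℚ ℝ) := by
      ext i j
      simp only [Matrix.map_apply, φ, AlgHom.toRingHom_eq_coe, RingHom.coe_coe, AlgHom.commutes]
    rw [e1, hF, ← eigenwave_map φ, Matrix.map_mul, ← compound_map φ, e2, e3]
  -- at a generic `s₀ ∈ V` the target vanishes (Thm. 5.4 for the evaluated chain)
  obtain ⟨s₀, hs₀V, hs₀⟩ := exists_algebraicIndependent_mem hVo hVne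
  have hdet : IsUnit (∑ i, s₀ i • (B i).map (Int.cast : ℤ → ℝ)).det :=
    isUnit_iff_ne_zero.2 (hVpd s₀ hs₀V).det_pos.ne'
  have hzero : eigenwave (q := 1) (compound 2 (∑ i, s₀ i • (B i).map (Int.cast : ℤ → ℝ)) *
      Mq.map (algebraMap ℚ ℝ)) = 0 := by
    rw [← hV s₀ hs₀V, ← Matrix.mul_assoc, compound_two_mul_nonsing_inv _ hdet, Matrix.one_mul]
    exact eigenwave_classOf _
  -- so `F = 0`, and the target vanishes everywhere
  have hF0 : F = 0 := by
    refine Matrix.ext fun K J => ?_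
    have h := congr_fun (congr_fun (hFeval s₀) K) J
    rw [hzero, Matrix.map_apply, Matrix.zero_apply] at h
    rw [Matrix.zero_apply]
    apply injective_aeval_of_algebraicIndependent' hs₀
    rw [map_zero]
    exact h
  rw [← hFeval s, hF0]
  ext K J
  simp

end Family

/-! ### The six-parameter family `F₊` and the rung -/

/-- The six-parameter period matrix of the rung, `Σ_{i<5} s_i ksForm i + s_5 B₆` with
`B₆ = B₁ R₂ R₃ R₄ R₅`, as the integral linear family of `Fin.snoc ksForm B₆`. [folklore] -/
theorem ksMatrixPlus_eq_linearFamily (s : Fin 6 → ℝ) :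
    (∑ i : Fin 5, s (Fin.castSucc i) • (ksForm i).map (Int.cast : ℤ → ℝ)) +
        s (Fin.last 5) • (ksBase * ksClifford 0 * ksClifford 1 * ksClifford 2 * ksClifford 3).map
          (Int.cast : ℤ → ℝ) =
      ∑ i : Fin 6, s i • ((Fin.snoc ksForm
        (ksBase * ksClifford 0 * ksClifford 1 * ksClifford 2 * ksClifford 3) :
          Fin 6 → Matrix (Fin 8) (Fin 8) ℤ) i).map (Int.cast : ℤ → ℝ) := by
  conv_rhs => rw [Fin.sum_univ_castSucc]
  simp only [Fin.snoc_castSucc, Fin.snoc_last]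

/-- **The rung `stub_rung_sixthDirection` follows from the kernel certificate `K₊ ∩ ℚ = ℚ • 1`.**
If every rational `28 × 28` matrix killed by the eigenwaves of the whole six-parameter family
`F₊` (i.e. `eigenwave (compound 2 (B⁺_s) · Mq) = 0` for all `s ∈ ℝ⁶`) is a rational multiple of
`1`, then every formal framed `2`-chain over `ℚ[s₀,…,s₅]` with constant rational period class `Mq`
on a non-empty open set of positive-definite parameters of `F₊` has `Mq ∈ ℚ • 1` — in particular the
registered rung (whose extra hypotheses affine-linearity, formal cycle condition and effectivity are
not needed), with the skeleton-local `ksSixth` / `ksMatrixPlus` / `evalChain₆` unfolded.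
[cite: MikhalkinZharkov2014Eigenwave, Thm. 5.4] [cite: Zharkov2020TropicalWeil, pp. 2–3] -/
theorem rung_sixthDirection_of_kernelCertificate
    (hK : ∀ Mq : Matrix (Sub 8 2) (Sub 8 2) ℚ,
      (∀ s : Fin 6 → ℝ, eigenwave (q := 1) (compound 2
        ((∑ i : Fin 5, s (Fin.castSucc i) • (ksForm i).map (Int.cast : ℤ → ℝ)) +
          s (Fin.last 5) • (ksBase * ksClifford 0 * ksClifford 1 * ksClifford 2 * ksClifford 3).map
            (Int.cast : ℤ → ℝ)) * Mq.map (algebraMap ℚ ℝ)) = 0) →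
      ∃ r : ℚ, Mq = r • (1 : Matrix (Sub 8 2) (Sub 8 2) ℚ)) :
    ∀ 𝒵 : Chain (MvPolynomial (Fin 6) ℚ) 8 2,
      ∀ V : Set (Fin 6 → ℝ), IsOpen V → V.Nonempty →
        (∀ s ∈ V, ((∑ i : Fin 5, s (Fin.castSucc i) • (ksForm i).map (Int.cast : ℤ → ℝ)) +
          s (Fin.last 5) • (ksBase * ksClifford 0 * ksClifford 1 * ksClifford 2 * ksClifford 3).map
            (Int.cast : ℤ → ℝ)).PosDef) →
        ∀ Mq : Matrix (Sub 8 2) (Sub 8 2) ℚ,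
          (∀ s ∈ V, compound 2 ((∑ i : Fin 5, s (Fin.castSucc i) • (ksForm i).map (Int.cast : ℤ → ℝ)) +
              s (Fin.last 5) • (ksBase * ksClifford 0 * ksClifford 1 * ksClifford 2 *
                ksClifford 3).map (Int.cast : ℤ → ℝ))⁻¹ *
            (⟨𝒵.size, fun c => ⟨fun r => MvPolynomial.aeval s ((𝒵.cell c).base r), (𝒵.cell c).dir,
                fun i j => MvPolynomial.aeval s ((𝒵.cell c).coef i j), (𝒵.cell c).weight⟩⟩ :
                Chain ℝ 8 2).classOf = Mq.map (algebraMap ℚ ℝ)) →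
          ∃ r : ℚ, Mq = r • (1 : Matrix (Sub 8 2) (Sub 8 2) ℚ) := by
  intro 𝒵 V hVo hVne hVpd Mq hV
  refine hK Mq fun s => ?_
  rw [ksMatrixPlus_eq_linearFamily]
  refine eigenwave_compound_linearFamily_mul_eq_zero _ 𝒵 V hVo hVne (fun s' hs' => ?_) Mq
    (fun s' hs' => ?_) s
  · rw [← ksMatrixPlus_eq_linearFamily]; exact hVpd s' hs'
  · rw [← ksMatrixPlus_eq_linearFamily]; exact hV s' hs'

/-- **The registered rung, conditional on the certificate** — `stub_rung_sixthDirection` verbatim up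
to unfolding of the skeleton-local definitions (its hypotheses `IsAffineLinear`, formal `IsCycle` and
`Effective` are carried but unused). [cite: MikhalkinZharkov2014Eigenwave, Thm. 5.4] -/
theorem stub_rung_sixthDirection_of_kernelCertificate
    (hK : ∀ Mq : Matrix (Sub 8 2) (Sub 8 2) ℚ,
      (∀ s : Fin 6 → ℝ, eigenwave (q := 1) (compound 2
        ((∑ i : Fin 5, s (Fin.castSucc i) • (ksForm i).map (Int.cast : ℤ → ℝ)) +
          s (Fin.last 5) • (ksBase * ksClifford 0 * ksClifford 1 * ksClifford 2 * ksClifford 3).map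
            (Int.cast : ℤ → ℝ)) * Mq.map (algebraMap ℚ ℝ)) = 0) →
      ∃ r : ℚ, Mq = r • (1 : Matrix (Sub 8 2) (Sub 8 2) ℚ)) :
    ∀ 𝒵 : Chain (MvPolynomial (Fin 6) ℚ) 8 2, 𝒵.IsAffineLinear →
      𝒵.IsCycle ((∑ i : Fin 5, (MvPolynomial.X (Fin.castSucc i) : MvPolynomial (Fin 6) ℚ) •
          (ksForm i).map (Int.cast : ℤ → MvPolynomial (Fin 6) ℚ)) +
        (MvPolynomial.X (Fin.last 5) : MvPolynomial (Fin 6) ℚ) •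
          (ksBase * ksClifford 0 * ksClifford 1 * ksClifford 2 * ksClifford 3).map
            (Int.cast : ℤ → MvPolynomial (Fin 6) ℚ)) →
      ∀ V : Set (Fin 6 → ℝ), IsOpen V → V.Nonempty →
        (∀ s ∈ V, ((∑ i : Fin 5, s (Fin.castSucc i) • (ksForm i).map (Int.cast : ℤ → ℝ)) +
          s (Fin.last 5) • (ksBase * ksClifford 0 * ksClifford 1 * ksClifford 2 * ksClifford 3).map
            (Int.cast : ℤ → ℝ)).PosDef) →
        ∀ Mq : Matrix (Sub 8 2) (Sub 8 2) ℚ,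
          (∀ s ∈ V,
            (⟨𝒵.size, fun c => ⟨fun r => MvPolynomial.aeval s ((𝒵.cell c).base r), (𝒵.cell c).dir,
                fun i j => MvPolynomial.aeval s ((𝒵.cell c).coef i j), (𝒵.cell c).weight⟩⟩ :
                Chain ℝ 8 2).Effective ∧
            compound 2 ((∑ i : Fin 5, s (Fin.castSucc i) • (ksForm i).map (Int.cast : ℤ → ℝ)) +
              s (Fin.last 5) • (ksBase * ksClifford 0 * ksClifford 1 * ksClifford 2 *
                ksClifford 3).map (Int.cast : ℤ → ℝ))⁻¹ *
            (⟨𝒵.size, fun c => ⟨fun r => MvPolynomial.aeval s ((𝒵.cell c).base r), (𝒵.cell c).dir,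
                fun i j => MvPolynomial.aeval s ((𝒵.cell c).coef i j), (𝒵.cell c).weight⟩⟩ :
                Chain ℝ 8 2).classOf = Mq.map (algebraMap ℚ ℝ)) →
          ∃ r : ℚ, Mq = r • (1 : Matrix (Sub 8 2) (Sub 8 2) ℚ) :=
  fun 𝒵 _ _ V hVo hVne hVpd Mq hV =>
    rung_sixthDirection_of_kernelCertificate hK 𝒵 V hVo hVne hVpd Mq fun s hs => (hV s hs).2

end Summit.HodgeConjecture.HodgeConjecture.Theorems.EffectiveCayleyNonRealizability

end
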